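import Mathlib.Probability.IdentDistrib
import Mathlib.Probability.HasLaw
import Mathlib.MeasureTheory.Function.ConvergenceInDistribution
import Literature.Probability.Process.BrownianMotion
import Literature.Probability.RandomPlanarGeometry.ConformalRectangle
import Literature.Probability.RandomPlanarGeometry.Curve
import Literature.Probability.RandomPlanarGeometry.CurveSpace
import Literature.Probability.RandomPlanarGeometry.LoewnerChain
import Literature.Probability.RandomPlanarGeometry.ConformalMap
import Literature.Probability.RandomPlanarGeometry.PlanarDomains
import HarnessLib

-- provenance: harness21/H21/H21/Prelude/Stoch/SLE.lean @ 7fbbdec (interim HEAD d8f2665); M5 mechanical rewrite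
/-!
# Chordal Schramm–Loewner evolution SLE_κ (trunk `Stoch`, prelude C12)

Chordal SLE_κ is formalised in two layers (architect's outline `Outlines/Stoch.md`, D2):

* **(i) the random Loewner chain.** On the canonical space `(ℝ≥0 → ℝ, Literature.preWienerMeasure)`
  carrying the canonical Brownian motion `Literature.Probability.Process.brownian`, the SLE_κ driving function is
  `Literature.sleDriving κ ω t = √κ · brownian t ω`; the SLE hulls, maps and trace are the deterministic
  Loewner objects (`Literature.Probability.RandomPlanarGeometry.Loewner.hull`, `Literature.Probability.RandomPlanarGeometry.Loewner.map`, `Literature.Probability.RandomPlanarGeometry.Loewner.trace`, prelude C11) of this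
  driving function. The Rohde–Schramm theorem "SLE_κ is generated by a curve" is the sorried
  known theorem `Literature.Probability.RandomPlanarGeometry.hasSLETrace_of_ne_eight` (and `Literature.Probability.RandomPlanarGeometry.hasSLETrace_eight` for `κ = 8`).
* **(ii) predicates on random curves and on laws.** For a Dobrushin domain `(D; a, b)`
  (`Literature.Probability.RandomPlanarGeometry.DobrushinDomain`), `Literature.IsSLECurve κ D Γ` says that the random variable
  `Γ : (ℝ≥0 → ℝ) → CurveClass ℂ` (curves modulo reparametrisation, prelude C9) is a.e.-measurable
  and is a.s. the time-compactified image of the SLE_κ trace under the boundary extension of a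
  chordal uniformizing map `φ : ℍₒ → D` (`0 ↦ a`, `∞ ↦ b`); `Literature.IsSLELaw κ D μ` says that `μ` is
  the law of such a `Γ`. Existence (`Literature.Probability.RandomPlanarGeometry.exists_isSLECurve`) and independence of the choice of
  `φ` (`Literature.Probability.RandomPlanarGeometry.IsSLECurve.map_eq`, Brownian scaling) are sorried known theorems, from which
  `Literature.Probability.RandomPlanarGeometry.existsUnique_isSLELaw` is proved.
* **Convergence in law to SLE** of lattice interfaces `X δ : Ωδ δ → CurveClass ℂ` (random variables
  on the mesh-`δ` configuration spaces of the lattice models of prelude G02) under laws `P δ` is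
  `Literature.ConvergesInLawToSLE κ D X P`, the bounded-continuous-test-function form (`Literature.Probability.RandomPlanarGeometry.TendstoLaw`)
  along `𝓝[>] 0`; `Literature.Probability.RandomPlanarGeometry.convergesInLawToSLE_iff_tendstoInDistribution` links it with Mathlib's
  `MeasureTheory.TendstoInDistribution` under probability instances.

Mathlib already provides, and we use: `UpperHalfPlane.upperHalfPlaneSet` (the open upper
half-plane as a subset of `ℂ`), `ProbabilityTheory.IsBrownianReal` and its scaling lemma
`IsBrownianReal.smul`, `ProbabilityTheory.IdentDistrib`, `MeasureTheory.TendstoInDistribution`.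
Mathlib has no Loewner chains or SLE.

Design choices.
* Time compactification `[0, ∞] ≃ [0, 1]` uses `Literature.rayParam s = s / (1 - s)` with the documented
  junk value `0` at `s = 1` (Lean's `x / 0 = 0`); `Literature.Probability.RandomPlanarGeometry.IsCompactifiedImage` only evaluates it on
  `s < 1` and prescribes the endpoint `b` at `s = 1` separately, so the junk value is never used.
* `ConvergesInLawToSLE` is never vacuous (`∃ Γ` is discharged by `exists_isSLECurve`) and needs no
  `IsProbabilityMeasure` instance and no measurability proof at definition time.

References: O. Schramm, *Scaling limits of loop-erased random walks and uniform spanning trees*,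
Israel J. Math. 118 (2000); S. Rohde, O. Schramm, *Basic properties of SLE*, Ann. Math. 161
(2005); G. Lawler, O. Schramm, W. Werner, *Conformal invariance of planar loop-erased random walks
and uniform spanning trees*, Ann. Probab. 32 (2004); G. Lawler, *Conformally invariant processes
in the plane*, AMS (2005), Ch. 6–7.
-/

noncomputable section

open Set Filter Topology MeasureTheory ProbabilityTheory
open UpperHalfPlane (upperHalfPlaneSet isOpen_upperHalfPlaneSet)
open scoped NNReal unitInterval

namespace Literature.Probability.RandomPlanarGeometry

/-! ### The SLE_κ driving function and the random Loewner chain -/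

section Driving

variable (κ : ℝ≥0)

/-- The **SLE_κ driving function** `Wₜ = √κ Bₜ` on the canonical space: `ω` is a sample point of
`(ℝ≥0 → ℝ, preWienerMeasure)` and `brownian` the canonical Brownian motion.
Schramm, Israel J. Math. 118 (2000), §1; Lawler (2005), Def. 6.1. [cite: Lawler2005] -/
def sleDriving (ω : ℝ≥0 → ℝ) (t : ℝ≥0) : ℝ :=
  Real.sqrt κ * Process.brownian t ω

/-- Unfolding lemma for `sleDriving`. [folklore] -/
theorem sleDriving_apply (ω : ℝ≥0 → ℝ) (t : ℝ≥0) :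
    sleDriving κ ω t = Real.sqrt κ * Process.brownian t ω := rfl

/-- Every path of the SLE_κ driving function is continuous (paths of `brownian` are continuous by
construction). Lawler (2005), Def. 6.1. [cite: Lawler2005] -/
theorem continuous_sleDriving (ω : ℝ≥0 → ℝ) : Continuous (sleDriving κ ω) :=
  continuous_const.mul (Process.continuous_brownian ω)

/-- Each marginal `ω ↦ sleDriving κ ω t` is measurable. Lawler (2005), Def. 6.1. [cite: Lawler2005] -/
@[fun_prop]
theorem measurable_sleDriving (t : ℝ≥0) : Measurable fun ω ↦ sleDriving κ ω t :=
  (Process.measurable_brownian t).const_mul _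

/-- The SLE_κ driving function, as a random element of the path space `ℝ≥0 → ℝ` with the
product σ-algebra, is measurable. Lawler (2005), Def. 6.1. [cite: Lawler2005] -/
@[fun_prop]
theorem measurable_sleDriving_pi : Measurable fun ω ↦ sleDriving κ ω :=
  measurable_pi_lambda _ (measurable_sleDriving κ)

/-- The SLE_κ driving function starts at `0`. Lawler (2005), Def. 6.1. [cite: Lawler2005] -/
@[simp]
theorem sleDriving_zero (ω : ℝ≥0 → ℝ) : sleDriving κ ω 0 = 0 := by
  simp [sleDriving, Process.brownian_zero]

/-- The **SLE_κ hull** `Kₜ(ω)`: the Loewner hull of the driving function `√κ B(ω)`.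
Schramm (2000), §1; Rohde–Schramm (2005), §1; Lawler (2005), Def. 6.1. [cite: Schramm2000] -/
def sleHull (ω : ℝ≥0 → ℝ) (t : ℝ≥0) : Set ℂ :=
  Loewner.hull (sleDriving κ ω) t

/-- The **SLE_κ Loewner map** `gₜ(ω) : ℂ → ℂ`: the Loewner map of the driving function `√κ B(ω)`
(junk value `z` after swallowing, see `Loewner.map`). Lawler (2005), Def. 6.1. [cite: Lawler2005] -/
def sleMap (ω : ℝ≥0 → ℝ) (t : ℝ≥0) : ℂ → ℂ :=
  Loewner.map (sleDriving κ ω) t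

/-- The **SLE_κ trace** `γ(ω) : ℝ≥0 → ℂ`: the Loewner trace of the driving function `√κ B(ω)`
(the generating curve when it exists, junk constant curve otherwise, see `Loewner.trace`).
Rohde–Schramm, Ann. Math. 161 (2005), §1 and Thm 5.1. [folklore] -/
def sleTrace (ω : ℝ≥0 → ℝ) : ℝ≥0 → ℂ :=
  Loewner.trace (sleDriving κ ω)

/-- Sanity: the SLE hull is by definition the Loewner hull of `t ↦ √κ · brownian t ω`. [folklore] -/
theorem sleHull_def (ω : ℝ≥0 → ℝ) (t : ℝ≥0) :
    sleHull κ ω t = Loewner.hull (fun s ↦ Real.sqrt κ * Process.brownian s ω) t := rfl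

/-- **SLE_κ is generated by a curve**, as a proposition: for `preWienerMeasure`-a.e. `ω` the
Loewner chain driven by `√κ B(ω)` is generated by a continuous curve.
Rohde–Schramm, Ann. Math. 161 (2005), Thm 5.1. [folklore] -/
def HasSLETrace : Prop :=
  ∀ᵐ ω ∂Process.preWienerMeasure, ∃ γ, Loewner.IsGeneratedByCurve (sleDriving κ ω) γ

end Driving

/-! ### Time compactification and the image of the trace in a Dobrushin domain -/

/-- The **ray parametrisation** `[0, 1] → [0, ∞)`, `s ↦ s / (1 - s)`, an increasing homeomorphism
`[0, 1) → [0, ∞)` used to compactify the time of the SLE trace. **Junk value** `0` at `s = 1`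
(Lean's `x / 0 = 0`); consumers only evaluate it on `s < 1`. Lawler (2005), §6.3 (chordal SLE
in a domain as a curve from `a` to `b`). [cite: Lawler2005] -/
def rayParam (s : I) : ℝ≥0 :=
  ⟨(s : ℝ) / (1 - s), div_nonneg s.2.1 (sub_nonneg.2 s.2.2)⟩

/-- Value of `rayParam`. [folklore] -/
@[simp]
theorem coe_rayParam (s : I) : (rayParam s : ℝ) = (s : ℝ) / (1 - s) := rfl

/-- `rayParam 0 = 0`. [folklore] -/
@[simp]
theorem rayParam_zero : rayParam 0 = 0 := by
  ext; simp

/-- `rayParam` is surjective onto `[0, ∞)` already from `[0, 1)`: every `t ≥ 0` is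
`rayParam s` for `s = t / (1 + t) < 1`. [folklore] -/
theorem exists_rayParam_eq (t : ℝ≥0) : ∃ s : I, (s : ℝ) < 1 ∧ rayParam s = t := by
  have ht : (0 : ℝ) ≤ t := t.2
  have h1 : (0 : ℝ) < 1 + t := by positivity
  refine ⟨⟨(t : ℝ) / (1 + t), div_nonneg ht h1.le, (div_le_one h1).2 (by linarith)⟩, ?_, ?_⟩
  · change (t : ℝ) / (1 + t) < 1
    rw [div_lt_one h1]
    linarith
  · ext
    simp only [coe_rayParam]
    field_simp
    ring

/-- The curve `c : [0, 1] → ℂ` is the **time-compactified image** of the half-infinite curve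
`γ : ℝ≥0 → ℂ` under `Φ : ℂ → ℂ` with endpoint `b`: `c s = Φ (γ (s / (1 - s)))` for `s < 1` and
`c 1 = b`. Used with `Φ` the boundary extension of a uniformizing map `ℍₒ → D`, `γ` the SLE trace
in `ℍₒ` and `b` the target boundary point. Lawler (2005), §6.3. [cite: Lawler2005] -/
def IsCompactifiedImage (Φ : ℂ → ℂ) (γ : ℝ≥0 → ℂ) (b : ℂ) (c : Curve ℂ) : Prop :=
  (∀ s : I, (s : ℝ) < 1 → c s = Φ (γ (rayParam s))) ∧ c 1 = b

/-! ### Chordal SLE_κ in a Dobrushin domain: predicates on random curves and on laws -/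

section Chordal

variable (κ : ℝ≥0) (D : DobrushinDomain)

/-- **Chordal SLE_κ in the Dobrushin domain `(D; a, b)` as a random curve.** The random variable
`Γ : (ℝ≥0 → ℝ) → CurveClass ℂ` on the canonical space is a chordal SLE_κ curve in `D` from
`a = D.pt 0` to `b = D.pt 1` if it is a.e.-measurable and there is a chordal uniformizing map
`φ : ℍₒ → D` (`0 ↦ a`, `∞ ↦ b`) such that, almost surely, the Loewner chain of `√κ B` is
generated by its trace and `Γ` is the class of the time-compactified image of the trace under
the boundary extension of `φ`, ending at `b`.
Schramm, Israel J. Math. 118 (2000), §1; Rohde–Schramm (2005), §1; Lawler (2005), §6.3. [cite: RohdeSchramm2005] -/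
def IsSLECurve (Γ : (ℝ≥0 → ℝ) → CurveClass ℂ) : Prop :=
  AEMeasurable Γ Process.preWienerMeasure ∧
    ∃ φ : ConformalEquiv upperHalfPlaneSet D.carrier, D.IsChordalUniformizing φ ∧
      ∀ᵐ ω ∂Process.preWienerMeasure, Loewner.IsGeneratedByCurve (sleDriving κ ω) (sleTrace κ ω) ∧
        ∃ c : Curve ℂ, Γ ω = CurveClass.mk c ∧
          IsCompactifiedImage φ.boundaryExtension (sleTrace κ ω) (D.pt 1) c

/-- **The law of chordal SLE_κ in `(D; a, b)`**: `μ` is the law (push-forward of the pre-Wiener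
measure) of some chordal SLE_κ random curve in `D`. A measure on `CurveClass ℂ`, curves modulo
reparametrisation. Schramm (2000), §1; Lawler (2005), §6.3. [cite: Schramm2000] -/
def IsSLELaw (μ : Measure (CurveClass ℂ)) : Prop :=
  ∃ Γ, IsSLECurve κ D Γ ∧ μ = Process.preWienerMeasure.map Γ

/-- **Convergence in law to chordal SLE_κ** as the mesh `δ → 0⁺`. The interfaces at mesh `δ` are
random variables `X δ : Ωδ δ → CurveClass ℂ` on the configuration spaces `Ωδ δ` of the lattice
models of prelude G02, with laws `P δ`; the statement is: there is a chordal SLE_κ random curve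
`Γ` in `D` such that `X δ` is eventually a.e.-measurable and `X δ → Γ` in law along `𝓝[>] 0`
(`TendstoLaw`, bounded continuous test functions). Never vacuous (`exists_isSLECurve`); linked
to Mathlib's `TendstoInDistribution` by `convergesInLawToSLE_iff_tendstoInDistribution`.
Smirnov, C. R. Acad. Sci. 333 (2001); Lawler (2005), §6.3; Billingsley (1999), §1.2. [cite: Lawler2005] -/
def ConvergesInLawToSLE {Ωδ : ℝ → Type*} [∀ δ, MeasurableSpace (Ωδ δ)]
    (X : ∀ δ, Ωδ δ → CurveClass ℂ) (P : ∀ δ, Measure (Ωδ δ)) : Prop :=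
  ∃ Γ, IsSLECurve κ D Γ ∧ (∀ᶠ δ in 𝓝[>] (0 : ℝ), AEMeasurable (X δ) (P δ)) ∧
    TendstoLaw X P Γ Process.preWienerMeasure

end Chordal

/-! ### Known theorems on the SLE trace (Rohde–Schramm, Lawler–Schramm–Werner) -/

section Trace

variable {κ : ℝ≥0}

/-- **Rohde–Schramm theorem**: for `κ ≠ 8`, chordal SLE_κ is almost surely generated by a
continuous curve. Rohde–Schramm, Ann. Math. 161 (2005), Thm 5.1. [cite: RohdeSchramm2005, Thm 5.1] -/
def hasSLETrace_of_ne_eight : Prop :=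
  ∀ {κ : ℝ≥0}, κ ≠ 8 → HasSLETrace κ

/-- **SLE₈ is generated by a curve** (as the scaling limit of the uniform spanning tree Peano
curve). Lawler–Schramm–Werner, Ann. Probab. 32 (2004), Thm 4.7 / §4. [cite: LawlerSchrammWerner2004, Thm 4.7] -/
def hasSLETrace_eight : Prop :=
  HasSLETrace 8

/-- SLE_κ is generated by a curve, for every `κ` (from the two named facts `hasSLETrace_eight`,
`hasSLETrace_of_ne_eight`, hypotheses `h8`, `hne`). Rohde–Schramm (2005), Thm 5.1, and
Lawler–Schramm–Werner (2004). [cite: RohdeSchramm2005] -/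
theorem hasSLETrace (h8 : hasSLETrace_eight) (hne : hasSLETrace_of_ne_eight) (κ : ℝ≥0) :
    HasSLETrace κ := by
  rcases eq_or_ne κ 8 with rfl | h
  · exact h8
  · exact hne h

/-- If SLE_κ is generated by a curve (`HasSLETrace κ`, see `hasSLETrace`), then almost surely the
SLE_κ Loewner chain is generated by its trace `sleTrace κ ω`.
Rohde–Schramm (2005), Thm 5.1. [cite: RohdeSchramm2005] -/
theorem ae_isGeneratedByCurve_sleTrace (hκ : HasSLETrace κ) :
    ∀ᵐ ω ∂Process.preWienerMeasure, Loewner.IsGeneratedByCurve (sleDriving κ ω) (sleTrace κ ω) := by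
  filter_upwards [hκ] with ω hω
  exact Loewner.isGeneratedByCurve_trace hω

/-- **Transience of the SLE trace**: for `κ > 0`, almost surely `|γ(t)| → ∞` as `t → ∞`.
Rohde–Schramm, Ann. Math. 161 (2005), Thm 7.1. [cite: RohdeSchramm2005, Thm 7.1] -/
def tendsto_norm_sleTrace_atTop : Prop :=
  ∀ {κ : ℝ≥0}, 0 < κ →
    ∀ᵐ ω ∂Process.preWienerMeasure, Tendsto (fun t ↦ ‖sleTrace κ ω t‖) atTop atTop

/-- **Brownian scaling of the driving function**: for `c ≠ 0` the processes `t ↦ √κ Bₜ` and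
`t ↦ c⁻¹ √κ B_{c² t}` have the same law on the path space `ℝ≥0 → ℝ` (product σ-algebra).
From Mathlib's `IsBrownianReal.smul` (equality of all finite-dimensional laws).
Rohde–Schramm (2005), §2; Lawler (2005), Prop. 6.5 (scaling of SLE). [cite: RohdeSchramm2005] -/
def identDistrib_sleDriving_scale : Prop :=
  ∀ (κ : ℝ≥0) {c : ℝ≥0}, c ≠ 0 →
    IdentDistrib (fun ω t ↦ sleDriving κ ω t) (fun ω t ↦ (c : ℝ)⁻¹ * sleDriving κ ω (c ^ 2 * t))
      Process.preWienerMeasure Process.preWienerMeasure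

end Trace

/-! ### Existence and uniqueness of the chordal SLE law -/

section Law

variable {κ : ℝ≥0} {D : DobrushinDomain} {Γ Γ' : (ℝ≥0 → ℝ) → CurveClass ℂ}
  {μ : Measure (CurveClass ℂ)}

/-- An SLE random curve is a.e.-measurable. [folklore] -/
theorem IsSLECurve.aemeasurable (h : IsSLECurve κ D Γ) : AEMeasurable Γ Process.preWienerMeasure := h.1

/-- **Existence of chordal SLE_κ in a Dobrushin domain** (`κ > 0`): the time-compactified image
of the SLE trace under the boundary extension of a chordal uniformizing map is a.s. a continuous
curve on `[0, 1]` ending at `b` (trace existence, Rohde–Schramm (2005) Thm 5.1 and LSW (2004);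
transience, RS05 Thm 7.1; boundary continuity of the uniformizing map of a Jordan domain,
Carathéodory), and its class is a measurable function of the Brownian path.
Lawler (2005), §6.3. [cite: RohdeSchramm2005] -/
def exists_isSLECurve : Prop :=
  ∀ {κ : ℝ≥0}, 0 < κ → ∀ D : DobrushinDomain, ∃ Γ, IsSLECurve κ D Γ

/-- **Independence of the uniformizing map**: two chordal SLE_κ random curves in the same
Dobrushin domain have the same law. Two chordal uniformizing maps differ by a dilation of `ℍₒ`
(`IsChordalUniformizing.exists_eq_trans_smul`), and the SLE trace is scale invariant in law
modulo time reparametrisation (Brownian scaling, `identDistrib_sleDriving_scale`, and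
`Loewner.hull_scale`). Rohde–Schramm (2005), §2; Lawler (2005), Prop. 6.5 and §6.3. [cite: RohdeSchramm2005] -/
def IsSLECurve.map_eq : Prop :=
  ∀ {κ : ℝ≥0} {D : DobrushinDomain} {Γ Γ' : (ℝ≥0 → ℝ) → CurveClass ℂ},
    IsSLECurve κ D Γ → IsSLECurve κ D Γ' → Process.preWienerMeasure.map Γ = Process.preWienerMeasure.map Γ'

/-- The law of an SLE random curve is an SLE law. [folklore] -/
theorem IsSLECurve.isSLELaw_map (h : IsSLECurve κ D Γ) : IsSLELaw κ D (Process.preWienerMeasure.map Γ) :=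
  ⟨Γ, h, rfl⟩

/-- **Chordal SLE_κ in `(D; a, b)` is a well-defined law** (`κ > 0`): there is exactly one
measure on `CurveClass ℂ` which is the law of a chordal SLE_κ random curve in `D`. Proved from
the named facts `exists_isSLECurve` (hypothesis `hex`) and `IsSLECurve.map_eq` (hypothesis
`huniq`). Schramm (2000), §1; Lawler (2005), §6.3. [cite: Schramm2000] -/
theorem existsUnique_isSLELaw (hex : exists_isSLECurve) (huniq : IsSLECurve.map_eq) (hκ : 0 < κ)
    (D : DobrushinDomain) : ∃! μ, IsSLELaw κ D μ := by
  obtain ⟨Γ, hΓ⟩ := hex hκ D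
  refine ⟨Process.preWienerMeasure.map Γ, hΓ.isSLELaw_map, ?_⟩
  rintro μ ⟨Γ', hΓ', rfl⟩
  exact huniq hΓ' hΓ

/-- Two SLE_κ laws in the same Dobrushin domain coincide (given `IsSLECurve.map_eq`, hypothesis
`huniq`). Lawler (2005), §6.3. [cite: Lawler2005] -/
theorem IsSLELaw.unique (huniq : IsSLECurve.map_eq) (h : IsSLELaw κ D μ)
    {μ' : Measure (CurveClass ℂ)} (h' : IsSLELaw κ D μ') : μ = μ' := by
  obtain ⟨Γ, hΓ, rfl⟩ := h
  obtain ⟨Γ', hΓ', rfl⟩ := h'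
  exact huniq hΓ hΓ'

/-- An SLE law is a probability measure (push-forward of the pre-Wiener probability measure by an
a.e.-measurable map, `isProbabilityMeasure_map`; the pre-Wiener measure is a probability measure
under the standing hypothesis `[Fact isProjectiveLimit_preWienerMeasure]` of `BrownianMotion`).
Lawler (2005), §6.3. [cite: Lawler2005] -/
theorem IsSLELaw.isProbabilityMeasure [Fact Process.isProjectiveLimit_preWienerMeasure]
    (h : IsSLELaw κ D μ) : IsProbabilityMeasure μ := by
  obtain ⟨Γ, hΓ, rfl⟩ := h
  exact Measure.isProbabilityMeasure_map hΓ.aemeasurable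

end Law

/-! ### Convergence in law to SLE and Mathlib's `TendstoInDistribution` -/

section Convergence

variable {κ : ℝ≥0} {D : DobrushinDomain} {Ωδ : ℝ → Type*} [∀ δ, MeasurableSpace (Ωδ δ)]
  {X : ∀ δ, Ωδ δ → CurveClass ℂ} {P : ∀ δ, Measure (Ωδ δ)}

/-- Under probability laws `P δ` and a.e.-measurable interfaces `X δ`, convergence in law to
chordal SLE_κ is Mathlib's convergence in distribution along `𝓝[>] 0` to some chordal SLE_κ
random curve (`tendstoLaw_iff_tendstoInDistribution`; portmanteau, Billingsley (1999), Thm 2.1).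
Lawler (2005), §6.3. [cite: Billingsley1999] -/
theorem convergesInLawToSLE_iff_tendstoInDistribution [Fact Process.isProjectiveLimit_preWienerMeasure]
    [∀ δ, IsProbabilityMeasure (P δ)]
    (hX : ∀ δ, AEMeasurable (X δ) (P δ)) :
    ConvergesInLawToSLE κ D X P ↔
      ∃ Γ, IsSLECurve κ D Γ ∧ TendstoInDistribution X (𝓝[>] (0 : ℝ)) Γ P Process.preWienerMeasure := by
  constructor
  · rintro ⟨Γ, hΓ, -, hT⟩
    exact ⟨Γ, hΓ, (tendstoLaw_iff_tendstoInDistribution hX hΓ.aemeasurable).1 hT⟩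
  · rintro ⟨Γ, hΓ, hT⟩
    exact ⟨Γ, hΓ, Eventually.of_forall fun δ ↦ hX δ,
      (tendstoLaw_iff_tendstoInDistribution hX hΓ.aemeasurable).2 hT⟩

/-- A family converging in law to chordal SLE_κ converges in law (`TendstoLaw`) to an SLE_κ
random curve whose law is the SLE_κ law. Lawler (2005), §6.3. [cite: Lawler2005] -/
theorem ConvergesInLawToSLE.exists_tendstoLaw (h : ConvergesInLawToSLE κ D X P) :
    ∃ Γ, IsSLELaw κ D (Process.preWienerMeasure.map Γ) ∧ TendstoLaw X P Γ Process.preWienerMeasure := by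
  obtain ⟨Γ, hΓ, -, hT⟩ := h
  exact ⟨Γ, hΓ.isSLELaw_map, hT⟩

end Convergence

/-! ### Discharge: Brownian scaling of the driving function -/

section Discharge

/-- **Brownian scaling of the SLE_κ driving function** (`identDistrib_sleDriving_scale`) holds:
if the canonical Brownian motion `brownian` is the junk process `0` both sides are the zero path;
otherwise `brownian` is a Brownian motion `B`, `t ↦ c⁻¹ B (c² t)` is again a Brownian motion
(Mathlib `IsBrownianReal.smul`), so all finite-dimensional laws of `√κ B` and `c⁻¹ √κ B(c² ·)`
agree, hence the laws on the path space agree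
(Mathlib `identDistrib_iff_forall_finset_identDistrib`). Rohde–Schramm (2005), Prop. 2.1 (i)
("follows from the scaling property of Brownian motion"); Lawler (2005), proof of Prop. 6.5.
[cite: RohdeSchramm2005, Prop. 2.1] -/
theorem identDistrib_sleDriving_scale_holds : identDistrib_sleDriving_scale := by
  intro κ c hc
  by_cases h : ∃ B : ℝ≥0 → (ℝ≥0 → ℝ) → ℝ, IsBrownianReal B Process.preWienerMeasure ∧
      (∀ t, Measurable (B t)) ∧ (∀ ω, Continuous (B · ω)) ∧ ∀ ω, B 0 ω = 0
  · have hB : IsBrownianReal Process.brownian Process.preWienerMeasure := Process.isBrownianReal_brownian h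
    haveI : IsProbabilityMeasure Process.preWienerMeasure := (hB.hasLaw ∅).isProbabilityMeasure
    have hB' : IsPreBrownianReal (fun t ω ↦ (√(c ^ 2 : ℝ≥0))⁻¹ * Process.brownian (c ^ 2 * t) ω)
        Process.preWienerMeasure := hB.toIsPreBrownianReal.smul (pow_ne_zero 2 hc)
    have hsq : (√(c ^ 2 : ℝ≥0) : ℝ) = c := by
      push_cast
      exact Real.sqrt_sq c.2
    -- measurability of the two path-valued maps
    have hm₁ : Measurable fun (ω : ℝ≥0 → ℝ) (t : ℝ≥0) ↦ sleDriving κ ω t :=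
      measurable_sleDriving_pi κ
    have hm₂ : Measurable fun (ω : ℝ≥0 → ℝ) (t : ℝ≥0) ↦ (c : ℝ)⁻¹ * sleDriving κ ω (c ^ 2 * t) :=
      measurable_pi_lambda _ fun t ↦ (measurable_sleDriving κ _).const_mul _
    rw [identDistrib_iff_forall_finset_identDistrib hm₁.aemeasurable hm₂.aemeasurable]
    intro J
    -- finite-dimensional laws of `B` and of the rescaled `B` agree
    have hJ : IdentDistrib (fun ω ↦ J.restrict (Process.brownian · ω))
        (fun ω ↦ J.restrict fun t ↦ (√(c ^ 2 : ℝ≥0))⁻¹ * Process.brownian (c ^ 2 * t) ω)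
        Process.preWienerMeasure Process.preWienerMeasure :=
      ⟨(hB.hasLaw J).aemeasurable, (hB'.hasLaw J).aemeasurable,
        by rw [(hB.hasLaw J).map_eq, (hB'.hasLaw J).map_eq]⟩
    have hu : Measurable fun (v : J → ℝ) (i : J) ↦ Real.sqrt κ * v i :=
      measurable_pi_lambda _ fun i ↦ (measurable_pi_apply i).const_mul _
    convert hJ.comp hu using 1
    · ext ω i
      simp [sleDriving]
    · ext ω i
      simp only [Function.comp_apply, Finset.restrict, sleDriving, hsq]
      ring
  · have hb : Process.brownian = 0 := by
      unfold Process.brownian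
      rw [dif_neg h]
    have h0 : (fun (ω : ℝ≥0 → ℝ) (t : ℝ≥0) ↦ (c : ℝ)⁻¹ * sleDriving κ ω (c ^ 2 * t)) =
        fun ω t ↦ sleDriving κ ω t := by
      ext ω t
      simp [sleDriving, hb]
    rw [h0]
    exact IdentDistrib.refl (measurable_sleDriving_pi κ).aemeasurable

end Discharge

end Literature.Probability.RandomPlanarGeometry
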